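import Literature.Computability.Complexity.HardcoreInapproximabilityProofs
import Literature.Analysis.Matrix.BennettTensorNorm
import Mathlib.Analysis.MeanInequalities
import HarnessLib

/-!
# The hard-core second-moment exponent is at most twice the first (Sly's Condition 1.2 via matrix norms)

Towards Sly 2010 Theorem 3.10 (the lower tail of the phase partition functions of the random
gadget, hypothesis `HT6` of `slyGadgetReduction_of_thm310`): the analytic crux of every
second-moment proof for the hard-core model on random bipartite `d`-regular (multi)graphs is
Sly's **Condition 1.2** — the exponential rate of `E[(Z^{α,β})²]` over pairs of configurations is
maximised by UNCORRELATED pairs, i.e. equals `2 Φ₁(α,β)`, at the dominant phase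
`(α,β) = (p⁺,p⁻)`. Mossel–Weitz–Wormald proved it for `λ` just above `λ_c(𝕋_d)`, Sly for
`d = 6, λ = 1`, Galanis–Ge–Štefankovič–Vigoda–Yang for `d = 3` and for `λ ≤ λ_{1/2}(d)` and
Galanis–Štefankovič–Vigoda (2016) for `d = 4, 5` — all but the first with computer-assisted
polynomial inequalities. Galanis–Štefankovič–Vigoda (JACM 2015, Theorem 1.4) found the
computer-free proof formalised here, valid for every `d` and `λ`: the rate of the second moment
of ANY spin system is a first-moment rate of the paired system with interaction matrix `B ⊗ B`;
first-moment rates are bounded by `Δ log ‖B‖_{p→Δ}` (`p = Δ/(Δ-1)`; Jensen + Hölder); and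
induced `p → q` norms are multiplicative over tensor products for `p ≤ q` (Bennett).

Contents (all proved; no named facts):
* `sum_mul_log_sub_log_le`, `sum_mul_log_sub_log_le'` — Gibbs' inequality (Jensen for `log`).
* `table_entropy_le_log` — the Jensen step: for a probability table `x` supported where `M > 0`,
  `Σ x(log M - log x) + e(Σ α log α + Σ β log β) ≤ log Σ M α^e β^e`, `e = (d-1)/d`.
* `sum_rpow_mul_le_norm` — the Hölder step; `table_entropy_le_log_normBound` — hence
  `… ≤ log K` whenever `‖M c‖_d ≤ K ‖c‖_p` on nonnegative vectors (GŠV15 eqs. (11)–(12)).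
* `slyBlam` — the hard-core interaction matrix with the activity pushed into the edges,
  `B_λ(i,j) = 𝟙[¬(i=j=1)] λ^{(i+j)/d}` on spins `Fin 2`.
* `log_norm_pow_le_slyPhi1`, `slyBlam_norm_pow_le`, `slyBlam_normBound` — the norm VALUE:
  `‖B_λ c‖_d ≤ e^{Φ₁(p⁺,p⁻)/d} ‖c‖_p` for all `c ≥ 0` (the easy half of GŠV15 Lemma 3.1, proved
  here without Lagrange multipliers: for `r = (B_λ c)^{d-1}` and the table `x ∝ B r cᵀ` Jensen is an
  EQUALITY, the column-marginal term is controlled by Gibbs' inequality, and the value is Sly's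
  `Φ₁` at the marginal densities, bounded by its global maximum `slyPhi1_le_of_critical`).
* `bennett_tensor_sq_le_real` — Bennett's inequality transferred to real matrices.
* `pair_table_entropy_le_two_slyPhi1` — **Condition 1.2 at the dominant phase, rate form**: for
  `d ≥ 3`, `λ > λ_c(𝕋_d)`, every probability table `x` of the paired hard-core model (plus-side
  spin pairs `(i,k)` against minus-side pairs `(j,l)`, no conflicting edge in either layer) obeys
  `d Σ x(log(B_λ(i,j)B_λ(k,l)) - log x) + (d-1)(Σ γ log γ + Σ δ log δ) ≤ 2 Φ₁(p⁺,p⁻)`.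

Not here (next files): the identification of this table rate with the logarithm of the terms of
the exact finite second-moment formula of Sly's model `G̃` (Sly (e:gt2Moment)); the equality case
(GŠV15 Lemma 3.2: maximisers are products — uniqueness in Condition 1.2); the non-degeneracy of
the Hessian at the product point and the Laplace evaluation with the exact constant `τ^{α,β}`
(MWW Theorem 6.11, Lemma 7.6).

## References
* A. Galanis, D. Štefankovič, E. Vigoda, *Inapproximability for antiferromagnetic spin systems in
  the tree non-uniqueness region*, J. ACM 62 (2015): §2 (eqs. (3)–(6)), §3 (Theorem 1.4, Lemma 3.1,
  eqs. (10)–(14), Lemma 3.2), §4 (Theorem 4.1, Lemma 4.3).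
* A. Sly, *Computational transition at the uniqueness threshold*, FOCS 2010, Condition 1.2, §3.
* E. Mossel, D. Weitz, N. Wormald, PTRF 143 (2009), §5 (the function `Φ₂`, Lemmas 5.1–5.2).
* G. Bennett, *Schur multipliers*, Duke Math. J. 44 (1977) (multiplicativity of `p → q` norms).
-/

namespace Literature.Computability.Complexity

open Real Finset Literature.Probability.LatticeModels

section Gibbs

variable {J : Type*} [Fintype J]

/-- **Gibbs' inequality / Jensen for `log`** on a finite set: for a probability vector `w` and
reals `y_j` that are positive wherever `w_j > 0`,
`Σ_j w_j (log y_j - log w_j) ≤ log Σ_{j : w_j > 0} y_j`. [folklore] -/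
theorem sum_mul_log_sub_log_le (w y : J → ℝ) (hw0 : ∀ j, 0 ≤ w j) (hw1 : ∑ j, w j = 1)
    (hy : ∀ j, 0 < w j → 0 < y j) :
    ∑ j, w j * (Real.log (y j) - Real.log (w j)) ≤
      Real.log (∑ j ∈ univ.filter (fun j => 0 < w j), y j) := by
  classical
  set t : Finset J := univ.filter fun j => 0 < w j with ht
  have hmem : ∀ j ∈ t, 0 < w j := fun j hj => (Finset.mem_filter.1 hj).2
  -- restrict the sum to the support of `w`
  have hsum : ∑ j, w j * (Real.log (y j) - Real.log (w j)) =
      ∑ j ∈ t, w j * (Real.log (y j) - Real.log (w j)) := by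
    rw [← Finset.sum_filter_add_sum_filter_not univ (fun j => 0 < w j)]
    rw [Finset.sum_eq_zero (s := univ.filter fun j => ¬0 < w j), add_zero]
    intro j hj
    have h0 : w j = 0 := le_antisymm (not_lt.1 (Finset.mem_filter.1 hj).2) (hw0 j)
    simp [h0]
  have hw1' : ∑ j ∈ t, w j = 1 := by
    rw [← hw1, ← Finset.sum_filter_add_sum_filter_not univ (fun j => 0 < w j)]
    rw [Finset.sum_eq_zero (s := univ.filter fun j => ¬0 < w j), add_zero]
    intro j hj
    exact le_antisymm (not_lt.1 (Finset.mem_filter.1 hj).2) (hw0 j)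
  -- Jensen for the concave `log` with weights `w` and points `y_j / w_j`
  have hJ := (strictConcaveOn_log_Ioi.concaveOn).le_map_sum (t := t) (w := w)
    (p := fun j => y j / w j) (fun j hj => (hmem j hj).le) hw1'
    (fun j hj => Set.mem_Ioi.2 (div_pos (hy j (hmem j hj)) (hmem j hj)))
  have hlhs : ∑ j ∈ t, w j • Real.log (y j / w j) = ∑ j ∈ t, w j * (Real.log (y j) - Real.log (w j)) := by
    refine Finset.sum_congr rfl fun j hj => ?_
    rw [smul_eq_mul, Real.log_div (hy j (hmem j hj)).ne' (hmem j hj).ne']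
  have hrhs : ∑ j ∈ t, w j • (y j / w j) = ∑ j ∈ t, y j := by
    refine Finset.sum_congr rfl fun j hj => ?_
    rw [smul_eq_mul, mul_div_cancel₀ _ (hmem j hj).ne']
  rw [hlhs, hrhs] at hJ
  rw [hsum]
  exact hJ

/-- Gibbs' inequality, with the full sum on the right when all `y_j ≥ 0`:
`Σ_j w_j (log y_j - log w_j) ≤ log Σ_j y_j`. [folklore] -/
theorem sum_mul_log_sub_log_le' (w y : J → ℝ) (hw0 : ∀ j, 0 ≤ w j) (hw1 : ∑ j, w j = 1)
    (hy0 : ∀ j, 0 ≤ y j) (hy : ∀ j, 0 < w j → 0 < y j) :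
    ∑ j, w j * (Real.log (y j) - Real.log (w j)) ≤ Real.log (∑ j, y j) := by
  classical
  refine (sum_mul_log_sub_log_le w y hw0 hw1 hy).trans (Real.log_le_log ?_ ?_)
  · -- the support is nonempty since `Σ w = 1`
    obtain ⟨j, hj⟩ : ∃ j, 0 < w j := by
      by_contra h
      have h' : ∀ j, w j ≤ 0 := fun j => not_lt.1 fun hj => h ⟨j, hj⟩
      have : ∑ j, w j = 0 := Finset.sum_eq_zero fun j _ => le_antisymm (h' j) (hw0 j)
      rw [hw1] at this
      exact one_ne_zero this
    exact Finset.sum_pos' (fun i hi => (hy0 i)) ⟨j, Finset.mem_filter.2 ⟨Finset.mem_univ _, hj⟩, hy j hj⟩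
  · exact Finset.sum_le_sum_of_subset_of_nonneg (Finset.filter_subset _ _) fun i _ _ => hy0 i

end Gibbs

section TableRate

variable {ι κ : Type*} [Fintype ι] [Fintype κ]

/-- **The Jensen step of the matrix-norm bound** (GŠV15 §3, proof of Lemma 3.1/Thm 1.4, weight-one
form): for a nonnegative matrix `M` and a probability table `x` on `ι × κ` supported where `M > 0`,
with marginals `α_i = Σ_j x_{ij}`, `β_j = Σ_i x_{ij}` and `e = (d-1)/d`,
`Σ_{ij} x_{ij}(log M_{ij} - log x_{ij}) + e(Σ_i α_i log α_i + Σ_j β_j log β_j)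
  ≤ log Σ_{ij} M_{ij} α_i^e β_j^e`.
[cite: GalanisStefankovicVigoda2015, §3.2–3.3 (proof of Theorem 1.4)] -/
theorem table_entropy_le_log (M x : ι → κ → ℝ) (hM : ∀ i j, 0 ≤ M i j) (hx : ∀ i j, 0 ≤ x i j)
    (hx1 : ∑ i, ∑ j, x i j = 1) (hsupp : ∀ i j, 0 < x i j → 0 < M i j) (e : ℝ) :
    ∑ i, ∑ j, x i j * (Real.log (M i j) - Real.log (x i j)) +
        e * (∑ i, (∑ j, x i j) * Real.log (∑ j, x i j) + ∑ j, (∑ i, x i j) * Real.log (∑ i, x i j)) ≤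
      Real.log (∑ i, ∑ j, M i j * (∑ j', x i j') ^ e * (∑ i', x i' j) ^ e) := by
  classical
  set α : ι → ℝ := fun i => ∑ j, x i j with hα
  set β : κ → ℝ := fun j => ∑ i, x i j with hβ
  have hα0 : ∀ i, 0 ≤ α i := fun i => Finset.sum_nonneg fun j _ => hx i j
  have hβ0 : ∀ j, 0 ≤ β j := fun j => Finset.sum_nonneg fun i _ => hx i j
  have hxα : ∀ i j, x i j ≤ α i := fun i j =>
    Finset.single_le_sum (f := fun j => x i j) (fun j _ => hx i j) (Finset.mem_univ j)
  have hxβ : ∀ i j, x i j ≤ β j := fun i j =>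
    Finset.single_le_sum (f := fun i => x i j) (fun i _ => hx i j) (Finset.mem_univ i)
  -- Gibbs on `ι × κ` with weights `x` and `y_{ij} = M_{ij} α_i^e β_j^e`
  set w : ι × κ → ℝ := fun ij => x ij.1 ij.2 with hw
  set y : ι × κ → ℝ := fun ij => M ij.1 ij.2 * α ij.1 ^ e * β ij.2 ^ e with hy
  have hw0 : ∀ ij, 0 ≤ w ij := fun ij => hx _ _
  have hw1 : ∑ ij, w ij = 1 := by rw [hw, Fintype.sum_prod_type]; exact hx1
  have hy0 : ∀ ij, 0 ≤ y ij := fun ij =>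
    mul_nonneg (mul_nonneg (hM _ _) (Real.rpow_nonneg (hα0 _) _)) (Real.rpow_nonneg (hβ0 _) _)
  have hypos : ∀ ij, 0 < w ij → 0 < y ij := by
    rintro ⟨i, j⟩ hij
    have hαi : 0 < α i := lt_of_lt_of_le hij (hxα i j)
    have hβj : 0 < β j := lt_of_lt_of_le hij (hxβ i j)
    exact mul_pos (mul_pos (hsupp i j hij) (Real.rpow_pos_of_pos hαi _)) (Real.rpow_pos_of_pos hβj _)
  have hG := sum_mul_log_sub_log_le' w y hw0 hw1 hy0 hypos
  -- expand `log y` on the support of `x`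
  have hexp : ∀ i j, x i j * (Real.log (y (i, j)) - Real.log (x i j)) =
      x i j * (Real.log (M i j) - Real.log (x i j)) + e * (x i j * Real.log (α i)) +
        e * (x i j * Real.log (β j)) := by
    intro i j
    rcases (hx i j).eq_or_lt with h0 | hpos
    · rw [← h0]; ring
    · have hαi : 0 < α i := lt_of_lt_of_le hpos (hxα i j)
      have hβj : 0 < β j := lt_of_lt_of_le hpos (hxβ i j)
      have hMij : 0 < M i j := hsupp i j hpos
      rw [hy]
      simp only
      rw [Real.log_mul (mul_pos hMij (Real.rpow_pos_of_pos hαi _)).ne' (Real.rpow_pos_of_pos hβj _).ne',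
        Real.log_mul hMij.ne' (Real.rpow_pos_of_pos hαi _).ne', Real.log_rpow hαi, Real.log_rpow hβj]
      ring
  have hlhs : ∑ ij, w ij * (Real.log (y ij) - Real.log (w ij)) =
      ∑ i, ∑ j, x i j * (Real.log (M i j) - Real.log (x i j)) +
        e * (∑ i, α i * Real.log (α i) + ∑ j, β j * Real.log (β j)) := by
    rw [hw, Fintype.sum_prod_type]
    simp only
    rw [Finset.sum_congr rfl fun i _ => Finset.sum_congr rfl fun j _ => hexp i j]
    simp only [Finset.sum_add_distrib, ← Finset.mul_sum]
    have h1 : ∑ i, ∑ j, x i j * Real.log (α i) = ∑ i, α i * Real.log (α i) := by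
      refine Finset.sum_congr rfl fun i _ => ?_
      rw [← Finset.sum_mul]
    have h2 : ∑ i, ∑ j, x i j * Real.log (β j) = ∑ j, β j * Real.log (β j) := by
      rw [Finset.sum_comm]
      refine Finset.sum_congr rfl fun j _ => ?_
      rw [← Finset.sum_mul]
    rw [h1, h2]
    ring
  have hrhs : ∑ ij, y ij = ∑ i, ∑ j, M i j * α i ^ e * β j ^ e := by
    rw [hy, Fintype.sum_prod_type]
  rw [hlhs, hrhs] at hG
  exact hG

/-- **The Hölder step**: `Σ_{ij} M_{ij} α_i^e β_j^e ≤ (Σ_i α_i)^e (Σ_i (Σ_j M_{ij} β_j^e)^d)^{1/d}`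
with `e = (d-1)/d` (Hölder with the conjugate exponents `d/(d-1)` and `d`).
[cite: GalanisStefankovicVigoda2015, §3.2 eq. (10) (matrix norm duality)] -/
theorem sum_rpow_mul_le_norm (M : ι → κ → ℝ) (hM : ∀ i j, 0 ≤ M i j) (α : ι → ℝ) (β : κ → ℝ)
    (hα : ∀ i, 0 ≤ α i) (hβ : ∀ j, 0 ≤ β j) {d : ℕ} (hd : 2 ≤ d) :
    ∑ i, ∑ j, M i j * α i ^ (((d : ℝ) - 1) / d) * β j ^ (((d : ℝ) - 1) / d) ≤
      (∑ i, α i) ^ (((d : ℝ) - 1) / d) *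
        (∑ i, (∑ j, M i j * β j ^ (((d : ℝ) - 1) / d)) ^ (d : ℝ)) ^ (1 / (d : ℝ)) := by
  have hd0 : (0 : ℝ) < d := by exact_mod_cast (by omega : 0 < d)
  have hd1 : (1 : ℝ) < d := by exact_mod_cast (by omega : 1 < d)
  set e : ℝ := ((d : ℝ) - 1) / d with he
  have he0 : 0 < e := by rw [he]; exact div_pos (by linarith) hd0
  -- conjugate exponents `p = d/(d-1)` and `d`
  have hpq : Real.HolderConjugate ((d : ℝ) / ((d : ℝ) - 1)) d :=
    { inv_add_inv_eq_inv := by rw [inv_one, inv_div]; field_simp; ring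
      left_pos := div_pos hd0 (by linarith)
      right_pos := hd0 }
  -- rewrite the double sum as `Σ_i α_i^e · g_i`
  have hfg : ∑ i, ∑ j, M i j * α i ^ e * β j ^ e = ∑ i, α i ^ e * ∑ j, M i j * β j ^ e := by
    refine Finset.sum_congr rfl fun i _ => ?_
    rw [Finset.mul_sum]
    refine Finset.sum_congr rfl fun j _ => ?_
    ring
  rw [hfg]
  have hH := Real.inner_le_Lp_mul_Lq_of_nonneg (s := (univ : Finset ι)) hpq
    (f := fun i => α i ^ e) (g := fun i => ∑ j, M i j * β j ^ e)
    (fun i _ => Real.rpow_nonneg (hα i) _)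
    (fun i _ => Finset.sum_nonneg fun j _ => mul_nonneg (hM i j) (Real.rpow_nonneg (hβ j) _))
  refine hH.trans (le_of_eq ?_)
  congr 1
  · -- `(Σ (α^e)^p)^{1/p} = (Σ α)^e` since `e p = 1` and `1/p = e`
    have h1 : ∀ i, (α i ^ e) ^ ((d : ℝ) / ((d : ℝ) - 1)) = α i := by
      intro i
      have hne : (d : ℝ) - 1 ≠ 0 := by linarith
      rw [← Real.rpow_mul (hα i), he, show ((d : ℝ) - 1) / d * (d / ((d : ℝ) - 1)) = 1 by
        field_simp [hne], Real.rpow_one]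
    simp only [h1]
    congr 1
    rw [he, one_div, inv_div]

end TableRate

section NormBound

variable {ι κ : Type*} [Fintype ι] [Fintype κ]

/-- **Entropy rate ≤ log of the `p → d` norm bound** (GŠV15 Theorem 1.4, the inequality
`Ψ ≤ Δ log ‖M‖_{p→Δ}` in weight-one form): if `‖M c‖_d ≤ K ‖c‖_p` for all nonnegative `c`
(`p = d/(d-1)`), then for every probability table `x` supported where `M > 0`, with marginals
`α`, `β` and `e = (d-1)/d`:
`Σ x(log M - log x) + e(Σ α log α + Σ β log β) ≤ log K`.
[cite: GalanisStefankovicVigoda2015, Theorem 1.4 with §3.2 eq. (11) (proof, eqs. (12)–(14))] -/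
theorem table_entropy_le_log_normBound (M x : ι → κ → ℝ) (hM : ∀ i j, 0 ≤ M i j)
    (hx : ∀ i j, 0 ≤ x i j) (hx1 : ∑ i, ∑ j, x i j = 1) (hsupp : ∀ i j, 0 < x i j → 0 < M i j)
    {d : ℕ} (hd : 2 ≤ d) {K : ℝ}
    (hK : ∀ c : κ → ℝ, (∀ j, 0 ≤ c j) →
      (∑ i, (∑ j, M i j * c j) ^ (d : ℝ)) ^ (1 / (d : ℝ)) ≤
        K * (∑ j, c j ^ ((d : ℝ) / ((d : ℝ) - 1))) ^ (((d : ℝ) - 1) / d)) :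
    ∑ i, ∑ j, x i j * (Real.log (M i j) - Real.log (x i j)) +
        ((d : ℝ) - 1) / d *
          (∑ i, (∑ j, x i j) * Real.log (∑ j, x i j) + ∑ j, (∑ i, x i j) * Real.log (∑ i, x i j)) ≤
      Real.log K := by
  classical
  have hd0 : (0 : ℝ) < d := by exact_mod_cast (by omega : 0 < d)
  have hd1 : (1 : ℝ) < d := by exact_mod_cast (by omega : 1 < d)
  set e : ℝ := ((d : ℝ) - 1) / d with he
  have he0 : 0 < e := by rw [he]; exact div_pos (by linarith) hd0
  set α : ι → ℝ := fun i => ∑ j, x i j with hα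
  set β : κ → ℝ := fun j => ∑ i, x i j with hβ
  have hα0 : ∀ i, 0 ≤ α i := fun i => Finset.sum_nonneg fun j _ => hx i j
  have hβ0 : ∀ j, 0 ≤ β j := fun j => Finset.sum_nonneg fun i _ => hx i j
  have hα1 : ∑ i, α i = 1 := hx1
  have hβ1 : ∑ j, β j = 1 := by rw [hβ, Finset.sum_comm]; exact hx1
  -- Jensen step
  have hJ := table_entropy_le_log M x hM hx hx1 hsupp e
  -- the sum inside the log is positive: pick a cell in the support of `x`
  set S : ℝ := ∑ i, ∑ j, M i j * α i ^ e * β j ^ e with hS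
  have hterm0 : ∀ i j, 0 ≤ M i j * α i ^ e * β j ^ e := fun i j =>
    mul_nonneg (mul_nonneg (hM _ _) (Real.rpow_nonneg (hα0 _) _)) (Real.rpow_nonneg (hβ0 _) _)
  have hSpos : 0 < S := by
    obtain ⟨i, j, hij⟩ : ∃ i j, 0 < x i j := by
      by_contra h
      have h' : ∀ i j, x i j = 0 := fun i j => le_antisymm (not_lt.1 fun hij => h ⟨i, j, hij⟩) (hx i j)
      have h0 : ∑ i, α i = 0 :=
        Finset.sum_eq_zero fun i _ => by rw [hα]; exact Finset.sum_eq_zero fun j _ => h' i j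
      rw [hα1] at h0
      exact one_ne_zero h0
    have hαi : 0 < α i := lt_of_lt_of_le hij
      (Finset.single_le_sum (f := fun j => x i j) (fun j _ => hx i j) (Finset.mem_univ j))
    have hβj : 0 < β j := lt_of_lt_of_le hij
      (Finset.single_le_sum (f := fun i => x i j) (fun i _ => hx i j) (Finset.mem_univ i))
    have hcell : 0 < M i j * α i ^ e * β j ^ e :=
      mul_pos (mul_pos (hsupp i j hij) (Real.rpow_pos_of_pos hαi _)) (Real.rpow_pos_of_pos hβj _)
    calc (0 : ℝ) < M i j * α i ^ e * β j ^ e := hcell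
      _ ≤ ∑ j', M i j' * α i ^ e * β j' ^ e :=
          Finset.single_le_sum (f := fun j' => M i j' * α i ^ e * β j' ^ e) (fun j' _ => hterm0 i j')
            (Finset.mem_univ j)
      _ ≤ S := Finset.single_le_sum (f := fun i' => ∑ j', M i' j' * α i' ^ e * β j' ^ e)
            (fun i' _ => Finset.sum_nonneg fun j' _ => hterm0 i' j') (Finset.mem_univ i)
  -- Hölder step and the norm bound
  have hH := sum_rpow_mul_le_norm M hM α β hα0 hβ0 hd
  have hK' := hK (fun j => β j ^ e) (fun j => Real.rpow_nonneg (hβ0 j) _)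
  have hnormβ : (∑ j, (β j ^ e) ^ ((d : ℝ) / ((d : ℝ) - 1))) ^ (((d : ℝ) - 1) / d) = 1 := by
    have h1 : ∀ j, (β j ^ e) ^ ((d : ℝ) / ((d : ℝ) - 1)) = β j := by
      intro j
      have hne : (d : ℝ) - 1 ≠ 0 := by linarith
      rw [← Real.rpow_mul (hβ0 j), he, show ((d : ℝ) - 1) / d * (d / ((d : ℝ) - 1)) = 1 by
        field_simp [hne], Real.rpow_one]
    simp only [h1, hβ1, Real.one_rpow]
  rw [hnormβ, mul_one] at hK'
  have hSK : S ≤ K := by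
    calc S ≤ (∑ i, α i) ^ e * (∑ i, (∑ j, M i j * β j ^ e) ^ (d : ℝ)) ^ (1 / (d : ℝ)) := hH
      _ = (∑ i, (∑ j, M i j * β j ^ e) ^ (d : ℝ)) ^ (1 / (d : ℝ)) := by rw [hα1, Real.one_rpow, one_mul]
      _ ≤ K := hK'
  calc _ ≤ Real.log S := hJ
    _ ≤ Real.log K := Real.log_le_log hSpos hSK

end NormBound

section HardCoreMatrix

/-- **The hard-core interaction matrix with the activity pushed into the edges** (GŠV15 §1.2:
"any external field can be pushed into the interaction matrix"): on spins `Fin 2` (`1` = occupied)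
`B_λ(i,j) = 0` if `i = j = 1`, else `λ^{(i+j)/d}` — so that on a `d`-regular graph
`Π_{edges} B_λ(σ_u,σ_v) = λ^{|σ|} · 𝟙[σ independent]`. [cite: GalanisStefankovicVigoda2015, §1.2 (interaction matrix; external field via congruence)] -/
noncomputable def slyBlam (d : ℕ) (lam : ℝ) (i j : Fin 2) : ℝ :=
  if i = 1 ∧ j = 1 then 0 else lam ^ ((((i : ℕ) : ℝ) + ((j : ℕ) : ℝ)) / d)

/-- Entries of `B_λ`. [folklore] -/
theorem slyBlam_apply (d : ℕ) (lam : ℝ) :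
    slyBlam d lam 0 0 = 1 ∧ slyBlam d lam 0 1 = lam ^ (1 / (d : ℝ)) ∧
      slyBlam d lam 1 0 = lam ^ (1 / (d : ℝ)) ∧ slyBlam d lam 1 1 = 0 := by
  refine ⟨?_, ?_, ?_, ?_⟩ <;> simp [slyBlam]

/-- `B_λ ≥ 0` for `λ ≥ 0`. [folklore] -/
theorem slyBlam_nonneg (d : ℕ) {lam : ℝ} (hlam : 0 ≤ lam) (i j : Fin 2) : 0 ≤ slyBlam d lam i j := by
  unfold slyBlam
  split_ifs
  · exact le_rfl
  · exact Real.rpow_nonneg hlam _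

/-- `Φ₁(0, 1) = log λ`: the all-minus configuration. [folklore] -/
theorem slyPhi1_zero_one (d : ℕ) (lam : ℝ) : slyPhi1 d lam 0 1 = Real.log lam := by
  simp [slyPhi1_def]

/-- `Φ₁(λ/(1+λ), 0) = log(1+λ)`: the plus side free, the minus side empty. [folklore] -/
theorem slyPhi1_free_zero (d : ℕ) {lam : ℝ} (hlam : 0 < lam) :
    slyPhi1 d lam (lam / (1 + lam)) 0 = Real.log (1 + lam) := by
  have h1 : 0 < 1 + lam := by linarith
  have hα : 1 - lam / (1 + lam) = 1 / (1 + lam) := by field_simp; ring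
  rw [slyPhi1_def]
  simp only [add_zero, Real.log_zero, mul_zero, sub_zero, Real.log_one]
  rw [hα, Real.log_div hlam.ne' h1.ne', one_div, Real.log_inv]
  field_simp
  ring

/-- Main case of `slyBlam_norm_pow_le` (both coordinates positive): with `t = λ^{1/d}`,
`v₀ = c₀ + t c₁`, `v₁ = t c₀`, `F = v₀^d + v₁^d` and `s = c₀^p + c₁^p` (`p = d/(d-1)`),
`log F ≤ Φ₁(α, β) + (d-1) log s` for the densities `α = v₁^d/F`, `β = t v₀^{d-1} c₁/F` of the
table `x ∝ B r cᵀ`, `r = v^{d-1}` (Jensen is an equality for this table; the only loss is Gibbs'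
inequality in the `c`-marginal). [cite: GalanisStefankovicVigoda2015, Lemma 3.1 and Theorem 4.1 (proof, §4.1)] -/
theorem log_norm_pow_le_slyPhi1 {d : ℕ} (hd : 2 ≤ d) {lam : ℝ} (hlam : 0 < lam) {c₀ c₁ : ℝ}
    (hc₀ : 0 < c₀) (hc₁ : 0 < c₁) :
    ∃ α β : ℝ, 0 < α ∧ 0 < β ∧ α + β < 1 ∧
      Real.log ((c₀ + lam ^ (1 / (d : ℝ)) * c₁) ^ d + (lam ^ (1 / (d : ℝ)) * c₀) ^ d) ≤
        slyPhi1 d lam α β + ((d : ℝ) - 1) *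
          Real.log (c₀ ^ ((d : ℝ) / ((d : ℝ) - 1)) + c₁ ^ ((d : ℝ) / ((d : ℝ) - 1))) := by
  have hd1 : 1 ≤ d := by omega
  have hdR : (0 : ℝ) < d := by exact_mod_cast (by omega : 0 < d)
  have hdR1 : (1 : ℝ) < d := by exact_mod_cast (by omega : 1 < d)
  have hdne : (d : ℝ) - 1 ≠ 0 := by linarith
  have hdm1 : ((d - 1 : ℕ) : ℝ) = (d : ℝ) - 1 := by rw [Nat.cast_sub hd1, Nat.cast_one]
  set t : ℝ := lam ^ (1 / (d : ℝ)) with ht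
  have ht0 : 0 < t := Real.rpow_pos_of_pos hlam _
  have hloglam : Real.log lam = d * Real.log t := by
    rw [ht, Real.log_rpow hlam]; field_simp
  set p : ℝ := (d : ℝ) / ((d : ℝ) - 1) with hp
  have hp0 : 0 < p := div_pos hdR (by linarith)
  have hpd : p * ((d : ℝ) - 1) = d := by rw [hp, div_mul_cancel₀ _ hdne]
  set s : ℝ := c₀ ^ p + c₁ ^ p with hs
  have hs0 : 0 < s := by rw [hs]; positivity
  set v₀ : ℝ := c₀ + t * c₁ with hv₀
  set v₁ : ℝ := t * c₀ with hv₁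
  have hv₀0 : 0 < v₀ := by positivity
  have hv₁0 : 0 < v₁ := by positivity
  set F : ℝ := v₀ ^ d + v₁ ^ d with hF
  have hF0 : 0 < F := by positivity
  -- the densities of the associated table
  set α : ℝ := v₁ ^ d / F with hα
  set β : ℝ := t * v₀ ^ (d - 1) * c₁ / F with hβ
  set x₀ : ℝ := v₀ ^ (d - 1) * c₀ / F with hx₀
  have hαpos : 0 < α := by positivity
  have hβpos : 0 < β := by positivity
  have hx₀pos : 0 < x₀ := by positivity
  have hv₀d : v₀ ^ d = v₀ ^ (d - 1) * v₀ := by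
    conv_lhs => rw [show d = d - 1 + 1 by omega, pow_succ]
  have hsum1 : α + β + x₀ = 1 := by
    rw [hα, hβ, hx₀]
    field_simp
    rw [hF, hv₀d, hv₀]
    ring
  have h1α : 1 - α = v₀ ^ d / F := by
    have : 1 - α = β + x₀ := by linarith
    rw [this, hβ, hx₀, hv₀d, hv₀]
    field_simp
    ring
  have hx₀eq : 1 - α - β = x₀ := by linarith
  refine ⟨α, β, hαpos, hβpos, by linarith, ?_⟩
  -- logarithms of the atoms
  have hLα : Real.log α = d * Real.log v₁ - Real.log F := by
    rw [hα, Real.log_div (by positivity) hF0.ne', Real.log_pow]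
  have hL1α : Real.log (1 - α) = d * Real.log v₀ - Real.log F := by
    rw [h1α, Real.log_div (by positivity) hF0.ne', Real.log_pow]
  have hLβ : Real.log β = Real.log t + (d - 1 : ℕ) * Real.log v₀ + Real.log c₁ - Real.log F := by
    rw [hβ, Real.log_div (by positivity) hF0.ne', Real.log_mul (by positivity) hc₁.ne',
      Real.log_mul ht0.ne' (by positivity), Real.log_pow]
  have hLx₀ : Real.log (1 - α - β) = (d - 1 : ℕ) * Real.log v₀ + Real.log c₀ - Real.log F := by
    rw [hx₀eq, hx₀, Real.log_div (by positivity) hF0.ne', Real.log_mul (by positivity) hc₀.ne',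
      Real.log_pow]
  have hLv₁ : Real.log v₁ = Real.log t + Real.log c₀ := by
    rw [hv₁, Real.log_mul ht0.ne' hc₀.ne']
  -- the key identity (Jensen with equality):
  -- `Φ₁(α,β) - log F = (d-1)[(1-β) log(1-β) + β log β] - d[(1-β) log c₀ + β log c₁]`
  have hkey : slyPhi1 d lam α β - Real.log F =
      ((d : ℝ) - 1) * ((1 - β) * Real.log (1 - β) + β * Real.log β) -
        d * ((1 - β) * Real.log c₀ + β * Real.log c₁) := by
    rw [slyPhi1_def, hLα, hL1α, hLx₀, hloglam, hLβ, hLv₁, hdm1]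
    ring
  -- Gibbs' inequality for the two-point distribution `(1-β, β)` against `(c₀^p, c₁^p)`
  have h1β0 : 0 ≤ 1 - β := by linarith
  have hGibbs : (1 - β) * (Real.log (c₀ ^ p) - Real.log (1 - β)) +
      β * (Real.log (c₁ ^ p) - Real.log β) ≤ Real.log s := by
    have h := sum_mul_log_sub_log_le' (J := Fin 2) ![1 - β, β] ![c₀ ^ p, c₁ ^ p]
      (by intro j; fin_cases j <;> simp [h1β0, hβpos.le])
      (by simp [Fin.sum_univ_two])
      (by intro j; fin_cases j <;> simp [Real.rpow_nonneg hc₀.le, Real.rpow_nonneg hc₁.le])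
      (by intro j _; fin_cases j <;> simp [Real.rpow_pos_of_pos hc₀, Real.rpow_pos_of_pos hc₁])
    simpa [Fin.sum_univ_two, hs] using h
  rw [Real.log_rpow hc₀, Real.log_rpow hc₁] at hGibbs
  have hd1' : (0 : ℝ) ≤ (d : ℝ) - 1 := by linarith
  have hG := mul_le_mul_of_nonneg_left hGibbs hd1'
  have hG' : ((d : ℝ) - 1) * ((1 - β) * (p * Real.log c₀ - Real.log (1 - β)) +
      β * (p * Real.log c₁ - Real.log β)) =
      d * ((1 - β) * Real.log c₀ + β * Real.log c₁) -
        ((d : ℝ) - 1) * ((1 - β) * Real.log (1 - β) + β * Real.log β) := by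
    linear_combination ((1 - β) * Real.log c₀ + β * Real.log c₁) * hpd
  rw [hG'] at hG
  change Real.log F ≤ slyPhi1 d lam α β + ((d : ℝ) - 1) * Real.log s
  linarith [hkey, hG]

/-- **The `p → d` norm of `B_λ` is at most `exp(Φ₁(p⁺,p⁻)/d)`** (the easy half of GŠV15
Lemma 3.1 `max Ψ₁ = Δ log ‖B‖_{p→Δ}`, for the hard-core model), in the homogeneous form
`‖B_λ c‖_d^d ≤ e^{Φ₁(p⁺,p⁻)} ‖c‖_p^{d}`, `p = d/(d-1)`, for all `c₀, c₁ ≥ 0`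
(`(B_λ c)_0 = c₀ + λ^{1/d} c₁`, `(B_λ c)_1 = λ^{1/d} c₀`): by `log_norm_pow_le_slyPhi1` and the
global maximum of `Φ₁` on the triangle (`slyPhi1_le_of_critical`); the degenerate cases `c₀ = 0`,
`c₁ = 0` are `Φ₁(0,1) = log λ` and `Φ₁(λ/(1+λ), 0) = log(1+λ)`.
[cite: GalanisStefankovicVigoda2015, Lemma 3.1 with Theorem 4.1] -/
theorem slyBlam_norm_pow_le {d : ℕ} (hd : 3 ≤ d) {lam pp pm : ℝ} (hlam : hardCoreThreshold d < lam)
    (hpm : 0 < pm) (hlt : pm < pp) (hsum : pp + pm < 1)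
    (hEα : lam * (1 - pp - pm) ^ d = pp * (1 - pp) ^ (d - 1))
    (hEβ : lam * (1 - pp - pm) ^ d = pm * (1 - pm) ^ (d - 1))
    {c₀ c₁ : ℝ} (hc₀ : 0 ≤ c₀) (hc₁ : 0 ≤ c₁) :
    (c₀ + lam ^ (1 / (d : ℝ)) * c₁) ^ d + (lam ^ (1 / (d : ℝ)) * c₀) ^ d ≤
      Real.exp (slyPhi1 d lam pp pm) *
        (c₀ ^ ((d : ℝ) / ((d : ℝ) - 1)) + c₁ ^ ((d : ℝ) / ((d : ℝ) - 1))) ^ (d - 1) := by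
  have hd1 : 1 ≤ d := by omega
  have hdR : (0 : ℝ) < d := by exact_mod_cast (by omega : 0 < d)
  have hdR1 : (1 : ℝ) < d := by exact_mod_cast (by omega : 1 < d)
  have hdne : (d : ℝ) - 1 ≠ 0 := by linarith
  have hdm1 : ((d - 1 : ℕ) : ℝ) = (d : ℝ) - 1 := by rw [Nat.cast_sub hd1, Nat.cast_one]
  have hlam0 : 0 < lam := (hardCoreThreshold_pos hd).trans hlam
  have hmax := slyPhi1_le_of_critical hd hlam hpm hlt hsum hEα hEβ
  have htd : (lam ^ (1 / (d : ℝ))) ^ d = lam := by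
    rw [← Real.rpow_natCast, ← Real.rpow_mul hlam0.le, one_div_mul_cancel hdR.ne', Real.rpow_one]
  have hp0 : 0 < (d : ℝ) / ((d : ℝ) - 1) := div_pos hdR (by linarith)
  -- `(c^p)^{d-1} = c^d`
  have hcpow : ∀ {c : ℝ}, 0 ≤ c → (c ^ ((d : ℝ) / ((d : ℝ) - 1))) ^ (d - 1) = c ^ d := by
    intro c hc
    rw [← Real.rpow_natCast, ← Real.rpow_mul hc, hdm1, div_mul_cancel₀ _ hdne, Real.rpow_natCast]
  rcases hc₀.eq_or_lt with h0 | hc₀pos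
  · -- `c₀ = 0`: `F = λ c₁^d`, `s^{d-1} = c₁^d`, and `log λ = Φ₁(0,1) ≤ Φ₁(p⁺,p⁻)`
    subst h0
    rw [zero_add, mul_zero, zero_pow (by omega : d ≠ 0), add_zero, Real.zero_rpow hp0.ne', zero_add,
      mul_pow, htd, hcpow hc₁]
    refine mul_le_mul_of_nonneg_right ?_ (pow_nonneg hc₁ _)
    have h := (hmax 0 1 le_rfl zero_le_one (by norm_num)).1
    rw [slyPhi1_zero_one] at h
    calc lam = Real.exp (Real.log lam) := (Real.exp_log hlam0).symm
      _ ≤ _ := Real.exp_le_exp.2 h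
  rcases hc₁.eq_or_lt with h1 | hc₁pos
  · -- `c₁ = 0`: `F = (1+λ) c₀^d` and `log(1+λ) = Φ₁(λ/(1+λ), 0) ≤ Φ₁(p⁺,p⁻)`
    subst h1
    rw [mul_zero, add_zero, Real.zero_rpow hp0.ne', add_zero, mul_pow, htd, hcpow hc₀,
      show c₀ ^ d + lam * c₀ ^ d = (1 + lam) * c₀ ^ d by ring]
    refine mul_le_mul_of_nonneg_right ?_ (pow_nonneg hc₀ _)
    have hα0 : 0 ≤ lam / (1 + lam) := div_nonneg hlam0.le (by linarith)
    have hα1 : lam / (1 + lam) + 0 ≤ 1 := by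
      rw [add_zero, div_le_one (by linarith)]; linarith
    have h := (hmax (lam / (1 + lam)) 0 hα0 le_rfl hα1).1
    rw [slyPhi1_free_zero d hlam0] at h
    calc 1 + lam = Real.exp (Real.log (1 + lam)) := (Real.exp_log (by linarith)).symm
      _ ≤ _ := Real.exp_le_exp.2 h
  -- main case
  obtain ⟨α, β, hα, hβ, hαβ, hlog⟩ := log_norm_pow_le_slyPhi1 (by omega : 2 ≤ d) hlam0 hc₀pos hc₁pos
  have hΦ : slyPhi1 d lam α β ≤ slyPhi1 d lam pp pm := (hmax α β hα.le hβ.le hαβ.le).1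
  have hF0 : 0 < (c₀ + lam ^ (1 / (d : ℝ)) * c₁) ^ d + (lam ^ (1 / (d : ℝ)) * c₀) ^ d := by
    have := Real.rpow_pos_of_pos hlam0 (1 / (d : ℝ))
    positivity
  have hs0 : 0 < c₀ ^ ((d : ℝ) / ((d : ℝ) - 1)) + c₁ ^ ((d : ℝ) / ((d : ℝ) - 1)) := by positivity
  rw [← Real.exp_log hF0]
  calc Real.exp (Real.log ((c₀ + lam ^ (1 / (d : ℝ)) * c₁) ^ d + (lam ^ (1 / (d : ℝ)) * c₀) ^ d))
      ≤ Real.exp (slyPhi1 d lam pp pm + ((d : ℝ) - 1) *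
          Real.log (c₀ ^ ((d : ℝ) / ((d : ℝ) - 1)) + c₁ ^ ((d : ℝ) / ((d : ℝ) - 1)))) :=
        Real.exp_le_exp.2 (by linarith)
    _ = _ := by
        rw [Real.exp_add]
        congr 1
        rw [show ((d : ℝ) - 1) * Real.log (c₀ ^ ((d : ℝ) / ((d : ℝ) - 1)) + c₁ ^ ((d : ℝ) / ((d : ℝ) - 1))) =
            Real.log ((c₀ ^ ((d : ℝ) / ((d : ℝ) - 1)) + c₁ ^ ((d : ℝ) / ((d : ℝ) - 1))) ^ (d - 1)) by
          rw [Real.log_pow, hdm1], Real.exp_log (pow_pos hs0 _)]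

end HardCoreMatrix

section PairBound

open NNReal in
/-- **Bennett's inequality, real-valued form** (from `Literature.Analysis.Matrix.bennett_tensor_sq_le`):
for a nonnegative real matrix `B` with `‖B c‖_d ≤ K ‖c‖_p` on nonnegative vectors, the tensor
square satisfies `‖(B ⊗ B) R‖_d ≤ K² ‖R‖_p` on nonnegative `R`. [cite: GalanisStefankovicVigoda2015, §3.3 eq. (13)] -/
theorem bennett_tensor_sq_le_real {ι κ : Type*} [Fintype ι] [Fintype κ] (B : ι → κ → ℝ)
    (hB0 : ∀ i j, 0 ≤ B i j) {p q : ℝ} (hp : 0 < p) (hpq : p ≤ q) {K : ℝ} (hK0 : 0 ≤ K)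
    (hK : ∀ c : κ → ℝ, (∀ j, 0 ≤ c j) →
      (∑ i, (∑ j, B i j * c j) ^ q) ^ (1 / q) ≤ K * (∑ j, c j ^ p) ^ (1 / p))
    (R : κ → κ → ℝ) (hR : ∀ j l, 0 ≤ R j l) :
    (∑ ik : ι × ι, (∑ jl : κ × κ, B ik.1 jl.1 * B ik.2 jl.2 * R jl.1 jl.2) ^ q) ^ (1 / q) ≤
      K ^ 2 * (∑ jl : κ × κ, R jl.1 jl.2 ^ p) ^ (1 / p) := by
  -- transfer to `ℝ≥0`
  set Bn : ι → κ → ℝ≥0 := fun i j => (B i j).toNNReal with hBn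
  set Rn : κ → κ → ℝ≥0 := fun j l => (R j l).toNNReal with hRn
  set Kn : ℝ≥0 := K.toNNReal with hKn
  have eB : ∀ i j, ((Bn i j : ℝ≥0) : ℝ) = B i j := fun i j => Real.coe_toNNReal _ (hB0 i j)
  have eR : ∀ j l, ((Rn j l : ℝ≥0) : ℝ) = R j l := fun j l => Real.coe_toNNReal _ (hR j l)
  have eK : ((Kn : ℝ≥0) : ℝ) = K := Real.coe_toNNReal _ hK0
  have hBn' : ∀ c : κ → ℝ≥0, (∑ i, (∑ j, Bn i j * c j) ^ q) ^ (1 / q) ≤ Kn * (∑ j, c j ^ p) ^ (1 / p) := by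
    intro c
    have h := hK (fun j => (c j : ℝ)) (fun j => (c j).2)
    rw [← NNReal.coe_le_coe]
    push_cast
    simp only [eB, eK]
    exact h
  have h := Literature.Analysis.Matrix.bennett_tensor_sq_le Bn hp hpq Kn hBn' Rn
  rw [← NNReal.coe_le_coe] at h
  push_cast at h
  simp only [eB, eR, eK] at h
  exact h

variable {d : ℕ} {lam pp pm : ℝ}

/-- The norm bound `‖B_λ c‖_d ≤ e^{Φ₁(p⁺,p⁻)/d} ‖c‖_{d/(d-1)}` on nonnegative vectors
(vector form of `slyBlam_norm_pow_le`). [cite: GalanisStefankovicVigoda2015, Lemma 3.1] -/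
theorem slyBlam_normBound (hd : 3 ≤ d) (hlam : hardCoreThreshold d < lam)
    (hpm : 0 < pm) (hlt : pm < pp) (hsum : pp + pm < 1)
    (hEα : lam * (1 - pp - pm) ^ d = pp * (1 - pp) ^ (d - 1))
    (hEβ : lam * (1 - pp - pm) ^ d = pm * (1 - pm) ^ (d - 1))
    (c : Fin 2 → ℝ) (hc : ∀ j, 0 ≤ c j) :
    (∑ i, (∑ j, slyBlam d lam i j * c j) ^ (d : ℝ)) ^ (1 / (d : ℝ)) ≤
      Real.exp (slyPhi1 d lam pp pm / d) *
        (∑ j, c j ^ ((d : ℝ) / ((d : ℝ) - 1))) ^ (((d : ℝ) - 1) / d) := by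
  have hd1 : 1 ≤ d := by omega
  have hdR : (0 : ℝ) < d := by exact_mod_cast (by omega : 0 < d)
  have hdm1 : ((d - 1 : ℕ) : ℝ) = (d : ℝ) - 1 := by rw [Nat.cast_sub hd1, Nat.cast_one]
  have hlam0 : 0 < lam := (hardCoreThreshold_pos hd).trans hlam
  obtain ⟨h00, h01, h10, h11⟩ := slyBlam_apply d lam
  have h := slyBlam_norm_pow_le hd hlam hpm hlt hsum hEα hEβ (hc 0) (hc 1)
  set s : ℝ := c 0 ^ ((d : ℝ) / ((d : ℝ) - 1)) + c 1 ^ ((d : ℝ) / ((d : ℝ) - 1)) with hs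
  have hs0 : 0 ≤ s := add_nonneg (Real.rpow_nonneg (hc 0) _) (Real.rpow_nonneg (hc 1) _)
  have ht0 : 0 ≤ lam ^ (1 / (d : ℝ)) := Real.rpow_nonneg hlam0.le _
  have hF0 : 0 ≤ (c 0 + lam ^ (1 / (d : ℝ)) * c 1) ^ d + (lam ^ (1 / (d : ℝ)) * c 0) ^ d := by
    have := hc 0; have := hc 1; positivity
  -- identify the two sides
  have hlhs : ∑ i, (∑ j, slyBlam d lam i j * c j) ^ (d : ℝ) =
      (c 0 + lam ^ (1 / (d : ℝ)) * c 1) ^ d + (lam ^ (1 / (d : ℝ)) * c 0) ^ d := by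
    simp only [Fin.sum_univ_two, h00, h01, h10, h11, one_mul, zero_mul, add_zero, Real.rpow_natCast]
  have hrhs : ∑ j, c j ^ ((d : ℝ) / ((d : ℝ) - 1)) = s := by
    simp only [Fin.sum_univ_two, hs]
  rw [hlhs, hrhs]
  have h' := Real.rpow_le_rpow hF0 h (one_div_pos.2 hdR).le
  refine h'.trans (le_of_eq ?_)
  rw [Real.mul_rpow (Real.exp_pos _).le (pow_nonneg hs0 _), ← Real.exp_mul, ← Real.rpow_natCast,
    ← Real.rpow_mul hs0, hdm1]
  congr 1
  · congr 1; field_simp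
  · congr 1; field_simp

/-- **The hard-core second-moment exponent is at most twice the first** (Sly's Condition 1.2 at
the dominant phase, in rate form; GŠV15 Theorem 1.4 `max Ψ₂ = 2 max Ψ₁` specialised to the
hard-core model, upper bound): for `d ≥ 3`, `λ > λ_c(𝕋_d)` with asymmetric critical point
`(p⁺, p⁻)` of `Φ₁`, every probability table `x` of the PAIRED hard-core model (pairs of spins
`(i,k)` on the plus side against pairs `(j,l)` on the minus side, supported on pairs of
non-conflicting edges `¬(i = j = 1)`, `¬(k = l = 1)`) satisfies
`d · Σ x (log(B_λ(i,j) B_λ(k,l)) - log x) + (d-1)(Σ γ log γ + Σ δ log δ) ≤ 2 Φ₁(p⁺, p⁻)`,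
`γ`, `δ` the marginals of `x`. Proof: Jensen + Hölder (`table_entropy_le_log_normBound`) against
the `p → d` norm of `B_λ ⊗ B_λ`, which is at most the square of that of `B_λ` (Bennett), which is
at most `e^{Φ₁(p⁺,p⁻)/d}` (`slyBlam_normBound`). [cite: GalanisStefankovicVigoda2015, Theorem 1.4 and Lemma 3.2 (eqs. (12)–(14)); Sly2010, Condition 1.2] -/
theorem pair_table_entropy_le_two_slyPhi1 (hd : 3 ≤ d) (hlam : hardCoreThreshold d < lam)
    (hpm : 0 < pm) (hlt : pm < pp) (hsum : pp + pm < 1)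
    (hEα : lam * (1 - pp - pm) ^ d = pp * (1 - pp) ^ (d - 1))
    (hEβ : lam * (1 - pp - pm) ^ d = pm * (1 - pm) ^ (d - 1))
    (x : Fin 2 × Fin 2 → Fin 2 × Fin 2 → ℝ) (hx : ∀ ik jl, 0 ≤ x ik jl)
    (hx1 : ∑ ik, ∑ jl, x ik jl = 1)
    (hsupp : ∀ ik jl, 0 < x ik jl → ¬(ik.1 = 1 ∧ jl.1 = 1) ∧ ¬(ik.2 = 1 ∧ jl.2 = 1)) :
    (d : ℝ) * ∑ ik, ∑ jl, x ik jl *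
        (Real.log (slyBlam d lam ik.1 jl.1 * slyBlam d lam ik.2 jl.2) - Real.log (x ik jl)) +
      ((d : ℝ) - 1) * (∑ ik, (∑ jl, x ik jl) * Real.log (∑ jl, x ik jl) +
        ∑ jl, (∑ ik, x ik jl) * Real.log (∑ ik, x ik jl)) ≤
      2 * slyPhi1 d lam pp pm := by
  have hd1 : 1 ≤ d := by omega
  have hdR : (0 : ℝ) < d := by exact_mod_cast (by omega : 0 < d)
  have hdR1 : (1 : ℝ) < d := by exact_mod_cast (by omega : 1 < d)
  have hlam0 : 0 < lam := (hardCoreThreshold_pos hd).trans hlam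
  set M : ℝ := slyPhi1 d lam pp pm with hM
  set K : ℝ := Real.exp (M / d) with hK
  have hK0 : 0 ≤ K := (Real.exp_pos _).le
  -- the paired interaction matrix
  set M₂ : Fin 2 × Fin 2 → Fin 2 × Fin 2 → ℝ :=
    fun ik jl => slyBlam d lam ik.1 jl.1 * slyBlam d lam ik.2 jl.2 with hM₂
  have hM₂0 : ∀ ik jl, 0 ≤ M₂ ik jl := fun ik jl =>
    mul_nonneg (slyBlam_nonneg d hlam0.le _ _) (slyBlam_nonneg d hlam0.le _ _)
  -- its `p → d` norm is at most `K²` (Bennett)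
  have hp0 : 0 < (d : ℝ) / ((d : ℝ) - 1) := div_pos hdR (by linarith)
  have hpq : (d : ℝ) / ((d : ℝ) - 1) ≤ d := by
    rw [div_le_iff₀ (by linarith)]
    have hdR2 : (2 : ℝ) ≤ d := by exact_mod_cast (by omega : 2 ≤ d)
    have h12 : (1 : ℝ) ≤ (d : ℝ) - 1 := by linarith
    calc (d : ℝ) = d * 1 := (mul_one _).symm
      _ ≤ d * ((d : ℝ) - 1) := mul_le_mul_of_nonneg_left h12 hdR.le
  have hpe : 1 / ((d : ℝ) / ((d : ℝ) - 1)) = ((d : ℝ) - 1) / d := by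
    rw [one_div, inv_div]
  have hB := bennett_tensor_sq_le_real (slyBlam d lam) (slyBlam_nonneg d hlam0.le) hp0 hpq hK0
    (fun c hc => by
      have h := slyBlam_normBound hd hlam hpm hlt hsum hEα hEβ c hc
      rw [hpe]; exact h)
  have hK₂ : ∀ c : Fin 2 × Fin 2 → ℝ, (∀ jl, 0 ≤ c jl) →
      (∑ ik, (∑ jl, M₂ ik jl * c jl) ^ (d : ℝ)) ^ (1 / (d : ℝ)) ≤
        K ^ 2 * (∑ jl, c jl ^ ((d : ℝ) / ((d : ℝ) - 1))) ^ (((d : ℝ) - 1) / d) := by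
    intro c hc
    have h := hB (fun j l => c (j, l)) (fun j l => hc (j, l))
    rw [hpe] at h
    simpa [hM₂, mul_assoc] using h
  -- support condition
  have hsupp' : ∀ ik jl, 0 < x ik jl → 0 < M₂ ik jl := by
    intro ik jl hpos
    obtain ⟨h1, h2⟩ := hsupp ik jl hpos
    have hpos' : ∀ i j : Fin 2, ¬(i = 1 ∧ j = 1) → 0 < slyBlam d lam i j := by
      intro i j hij
      unfold slyBlam
      rw [if_neg hij]
      exact Real.rpow_pos_of_pos hlam0 _
    exact mul_pos (hpos' _ _ h1) (hpos' _ _ h2)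
  have hmain := table_entropy_le_log_normBound M₂ x hM₂0 hx hx1 hsupp' (by omega : 2 ≤ d) hK₂
  have hlogK : Real.log (K ^ 2) = 2 * (M / d) := by
    rw [Real.log_pow, hK, Real.log_exp]; push_cast; ring
  rw [hlogK] at hmain
  -- multiply by `d`
  have := mul_le_mul_of_nonneg_left hmain hdR.le
  have hdne : (d : ℝ) ≠ 0 := hdR.ne'
  calc (d : ℝ) * ∑ ik, ∑ jl, x ik jl * (Real.log (M₂ ik jl) - Real.log (x ik jl)) +
        ((d : ℝ) - 1) * (∑ ik, (∑ jl, x ik jl) * Real.log (∑ jl, x ik jl) +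
          ∑ jl, (∑ ik, x ik jl) * Real.log (∑ ik, x ik jl))
      = (d : ℝ) * (∑ ik, ∑ jl, x ik jl * (Real.log (M₂ ik jl) - Real.log (x ik jl)) +
          ((d : ℝ) - 1) / d * (∑ ik, (∑ jl, x ik jl) * Real.log (∑ jl, x ik jl) +
            ∑ jl, (∑ ik, x ik jl) * Real.log (∑ ik, x ik jl))) := by
        field_simp
    _ ≤ (d : ℝ) * (2 * (M / d)) := this
    _ = 2 * M := by field_simp

end PairBound

end Literature.Computability.Complexity
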